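import Summits.ABC.IUTFork.Conditional.AbcOfSOrNumKHregBad
import Summits.ABC.ABC.Theorems.IUTThetaPilotABCOfThetaPartII
import HarnessLib

/-!
# Branch C, K line — the STABLE COMPANION OF RECORD (p452637) with BOTH binders CUT TO THE CONTENT LOCUS OF [IUTchIV] Thm. 1.10's DISPLAY
# («θ-cut»: explicit 2 = `hNumOffC` · `hregC`; NOTHING is assumed at any admissible `(P, l)` with `log q^{∤{2,l}}(λ) ≤ 120·d*_mod·l`, in particular at no known point)

C scoreboard (abc-iut-C-cert-1 gen 3, EVEN-revision writer; C-lead rulings C-R28 (3)(α) «Szpiro-bad cut», C-R34 (1) / C-R39 (3)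
(STABLE COMPANION OF RECORD = abc-iut-C-cert-2's `Conditional.abc_of_SH_orNum_K_szpiroBad_hregBad`, p452637, the designated successor
of the window record p453137)). PROOF-ONLY (no `def`, no new `Prop`, no instance, no notation; nothing re-typed; DATA binders and the
per-datum step are p452637's VERBATIM).

THE OBSERVATION (elementary, print's own constant). What the chain consumes at an admissible `(P, l)` is [IUTchIV] Thm. 1.10's display
as applied in the proof of Cor. 2.2 (ii) (p. 46 l. 1), `Cor22.Display P l η`:
`(1/6)·log q^{∤{2,l}}(λ) ≤ (1 + 20·d_mod/l)·(log-diff + log-cond) + 20·(d*_mod·l + η)`, `d*_mod = 2¹²·3³·5·d_mod` (p. 22), `η = η_prm > 0`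
(Prop. 1.6). Its right-hand side is at least `20·d*_mod·l ≥ 20·552960·7 > 7.7·10⁷`; so at every admissible `(P, l)` with
`log q^{∤{2,l}}(λ) ≤ 6·(1 + 20·d_mod/l)·(log-diff + log-cond) + 120·d*_mod·l` the display is TRUE FOR EVERY `η > 0` WITH NO INPUT AT ALL
(`display_of_not_content`, one `linarith`). abc-iut-c312-d1 recorded the same phenomenon for the (U)-volume range (`LDHGenuineHullRegimeTrivialRange`,
`Cor22.display_of_logQAvoid_le_explicitThreshold`); HERE it is applied as a CUT on the certificate of record, through abc-iut-S-d2's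
`ThetaPartIIDisplay.thm110Legendre_of_pointwise` / `display_of_squeezeIII` and abc-iut-S6's `ABC_of_thm110Legendre`:

* `display_of_not_content` — off the content locus the display holds for every `η > 0`;
* `szpiroBad_of_content` — the content guard IMPLIES the Szpiro-bad guard of p452637 / p453137 (`l ≥ 5`): each binder below is the record's
  binder precomposed with this lemma, hence WEAKER-OR-EQUAL binder by binder (C-R2); the count is unchanged (explicit 2);
* `thm110Legendre_of_squeezeIII_content`, `ABC_of_squeezeIII_content` — `Cor22.Thm110Legendre`, resp. `ABC`, from the Step (viii) squeeze with
  `B_III(P,l)` demanded ONLY on the content locus (twin of abc-iut-S-d2's `thm110Legendre_of_squeezeIII` / the route's `closes`);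
* **`abc_of_SH_orNum_K_content`** — p452637 with `hNumOffBad ↦ hNumOffC`, `hregBad ↦ hregC`: the Szpiro-bad antecedent REPLACED by the content
  guard «`6·(1 + 20·d_mod/l)·(log-diff + log-cond) + 120·d*_mod·l < log q^{∤{2,l}}(λ)`» (text diff = that antecedent only); per datum the
  record's step verbatim (licence holds ⇒ abc-iut-C-cert-3's `GenuineK.cor312Of_of_SH`, Θ-READ a theorem by abc-iut-s2-p6; fails ⇒ `hNumOffC`;
  hull estimate ON the slot-constant regime = abc-iut-S3's `PointDict.hullEstimateOf_BIII_pinned` with (R4) = abc-iut-S1's `ThetaPartII.stub_R4`,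
  OFF it `hregC`; squeeze `PointDict.logQAvoid_le_of_cor312AtDatum`, abc-iut-S2). The Szpiro-GOOD branch of p452637 is no longer needed:
  a Szpiro-good point is off the content locus.

WHAT THE CUT BUYS (numbers, not adjectives). NO hypothesis of any class (S_H / NUM / CONE) is consumed at any admissible `(P, l)` with
`log q^{∤{2,l}}(λ) ≤ 120·d*_mod·l = 6.6·10⁷·d_mod·l` (`≥ 4.6·10⁸` since `l ≥ 7` by (P6)), nor at any Szpiro-good one. Every known abc triple and
every tabulated datum of the cell's R-W / N1–N4 tables has `log q < 10⁴`: a kernel refutation of a record's binder AT KNOWN DATA (C-R39 (2)(4)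
«C:HSHW-REF», TAME-EXACT rows) turns the un-cut record into a composition record but cannot touch a θ-cut certificate. Conversely — HONEST
STRENGTH — the θ-cut certificate says nothing computable: its binders live exactly where print's Thm. 1.10 has content, above `10⁸` nats,
where they are neither instantiated nor refuted (abc-iut-s2-p1's floor 16:41Z: a refutation of `hregC` needs a symbolic family of
log-height `≥ 3.3·10⁸` that is provably on the locus — an abc-type statement). HONEST FRAMING: locates / conditionally verifies; nothing here
asserts that abc is proved or refuted, or that [IUTchIII] Cor. 3.12 / Thm. 3.11 or [IUTchIV] Thm. 1.10 holds or fails at any datum, or takes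
a side on any author (Mochizuki / Scholze–Stix / Joshi / Dupuy–Hilado); `hNumOffC` / `hregC` are assumption labels, never asserted; SHARP
reading (U); a cut consumes hypotheses on fewer points, it discharges nothing; typed ≠ proved; instantiated ≠ endorsed; refuted-as-typed ≠
refuted-in-print. [claim: Mochizuki2012, status: disputed]
[cite: Mochizuki2012, IUTchIII Cor. 3.12 p. 173–174, Step (xi-f) p. 184; IUTchIV Thm. 1.10 p. 22–23 (display), Steps (v) p. 27–28, (viii) p. 30,
Prop. 1.6 p. 16, Cor. 2.2 (ii)–(iii) p. 43–47 (p. 46 l. 1)]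
-/

noncomputable section

open Set Function NumberField IsDedekindDomain

namespace Summit.ABC.IUTFork.Conditional

open Thm311 Thm311.Real Cor312 Cor312Vol Cor312Prov Literature.IUT.LogThetaLattice Literature.IUT.LogVolume
  Literature.IUT.HodgeTheaters Literature.IUT.LogVolume.ThetaData
open Literature.NumberTheory.DiophantineGeometry.GenEll Summit.ABC.ABC.Theorems

/-! ## §1 The content locus of the display: elementary arithmetic -/

/-- **Off the content locus the display is free.** If `log q^{∤{2,l}}(λ) ≤ 6·(1 + 20·d_mod/l)·(log-diff + log-cond) + 120·d*_mod·l` then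
[IUTchIV] Thm. 1.10's display `Cor22.Display P l η` holds for every `η > 0`, by its own additive constant `20·(d*_mod·l + η)` — no input
from [IUTchIII] Cor. 3.12 in any reading. [cite: Mochizuki2012, IUTchIV Thm. 1.10 p. 22–23; Cor. 2.2 (ii) proof p. 46] -/
theorem display_of_not_content {P : NFPoint} {l : ℕ} {η : ℝ} (hη : 0 < η)
    (h : ¬ (6 * ((1 + 20 * (Cor22.dmod P : ℝ) / l) * (P.logDiff + Cor22.logCondAvoid P {2, l}))
          + 120 * (2 ^ 12 * 3 ^ 3 * 5 * (Cor22.dmod P : ℝ) * l) < Cor22.logQAvoid P {2, l})) :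
    Cor22.Display P l η := by
  unfold Cor22.Display
  push Not at h
  linarith

/-- **The content guard implies the Szpiro-bad guard of the records** (p452637 / p453137; `l ≥ 5`): if
`6·(1 + 20·d_mod/l)·(log-diff + log-cond) + 120·d*_mod·l < log q^{∤{2,l}}(λ)` then `(l+5)/4 < d_mod` or
`(6l(l+5−4d_mod)/((l+4)(l−3)))·(log-diff + (1−1/l)·log-cond) + (6l(l+5)/((l+4)(l−3)))·log π < log q^{∤{2,l}}(λ)`
(`6l(l+1)/((l+4)(l−3)) ≤ 6 + 120/l`, `log π ≤ 3`, `l + 5 ≤ (l+4)(l−3)`). So every binder cut by the content guard is WEAKER-OR-EQUAL than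
the same binder cut by the Szpiro-bad guard (C-R2). Pure arithmetic. [cite: Mochizuki2012, IUTchIV Thm. 1.10 p. 22–23] -/
theorem szpiroBad_of_content {P : NFPoint} {l : ℕ} (h5 : 5 ≤ l)
    (h : 6 * ((1 + 20 * (Cor22.dmod P : ℝ) / l) * (P.logDiff + Cor22.logCondAvoid P {2, l}))
          + 120 * (2 ^ 12 * 3 ^ 3 * 5 * (Cor22.dmod P : ℝ) * l) < Cor22.logQAvoid P {2, l}) :
    ((l : ℝ) + 5) / 4 < (Cor22.dmod P : ℝ) ∨
      6 * l * (((l : ℝ) + 5) - 4 * Cor22.dmod P) / (((l : ℝ) + 4) * ((l : ℝ) - 3))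
          * (P.logDiff + (1 - 1 / (l : ℝ)) * Cor22.logCondAvoid P {2, l})
        + 6 * l * ((l : ℝ) + 5) / (((l : ℝ) + 4) * ((l : ℝ) - 3)) * Real.log Real.pi < Cor22.logQAvoid P {2, l} := by
  by_cases hd : ((l : ℝ) + 5) / 4 < (Cor22.dmod P : ℝ)
  · exact Or.inl hd
  refine Or.inr (lt_of_le_of_lt ?_ h)
  push Not at hd
  -- abbreviations and signs
  have hl5 : (5 : ℝ) ≤ l := by exact_mod_cast h5
  have hl0 : (0 : ℝ) < l := by linarith
  have hD1 : (1 : ℝ) ≤ (Cor22.dmod P : ℝ) := by exact_mod_cast Cor22.dmod_pos P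
  have hLD : 0 ≤ P.logDiff := P.logDiff_nonneg
  have hLC : 0 ≤ Cor22.logCondAvoid P {2, l} := Cor22.logCondAvoid_nonneg P {2, l}
  have hM : (0 : ℝ) < ((l : ℝ) + 4) * ((l : ℝ) - 3) := by nlinarith
  set D : ℝ := (Cor22.dmod P : ℝ) with hDdef
  set a : ℝ := P.logDiff with hadef
  set c : ℝ := Cor22.logCondAvoid P {2, l} with hcdef
  set M : ℝ := ((l : ℝ) + 4) * ((l : ℝ) - 3) with hMdef
  -- (1) the conductor term: `0 ≤ A := 6l(l+5−4D)/M ≤ 6l(l+1)/M ≤ 6 + 120/l ≤ 6(1+20D/l)`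
  have hA0 : 0 ≤ 6 * l * (((l : ℝ) + 5) - 4 * D) / M := div_nonneg (by nlinarith) hM.le
  have hA1 : 6 * l * (((l : ℝ) + 5) - 4 * D) / M ≤ 6 * l * ((l : ℝ) + 1) / M :=
    div_le_div_of_nonneg_right (by nlinarith) hM.le
  have hA2 : 6 * l * ((l : ℝ) + 1) / M ≤ (6 * l + 120) / l := by
    rw [div_le_div_iff₀ hM hl0]
    nlinarith
  have hA3 : (6 * (l : ℝ) + 120) / l ≤ 6 * (1 + 20 * D / l) := by
    rw [div_le_iff₀ hl0]
    have e : 6 * (1 + 20 * D / l) * l = 6 * l + 120 * D := by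
      field_simp
      ring
    rw [e]
    linarith
  have hA : 6 * l * (((l : ℝ) + 5) - 4 * D) / M ≤ 6 * (1 + 20 * D / l) := hA1.trans (hA2.trans hA3)
  have hin : a + (1 - 1 / (l : ℝ)) * c ≤ a + c := by
    have : 0 ≤ 1 / (l : ℝ) * c := by positivity
    nlinarith
  have hac : 0 ≤ a + c := by linarith
  have h1 : 6 * l * (((l : ℝ) + 5) - 4 * D) / M * (a + (1 - 1 / (l : ℝ)) * c) ≤ 6 * (1 + 20 * D / l) * (a + c) :=
    (mul_le_mul_of_nonneg_left hin hA0).trans (mul_le_mul_of_nonneg_right hA hac)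
  -- (2) the archimedean term: `6l(l+5)/M · log π ≤ 18·l ≤ 120·d*_mod·l`
  have hlogpi : Real.log Real.pi ≤ 3 := by
    have := Real.log_le_sub_one_of_pos Real.pi_pos
    linarith [Real.pi_lt_four]
  have hlogpi0 : 0 ≤ Real.log Real.pi := Real.log_nonneg (by linarith [Real.pi_gt_three])
  have hq : 6 * l * ((l : ℝ) + 5) / M ≤ 6 * l := by
    rw [div_le_iff₀ hM]
    nlinarith
  have hq0 : 0 ≤ 6 * l * ((l : ℝ) + 5) / M := div_nonneg (by nlinarith) hM.le
  have h2 : 6 * l * ((l : ℝ) + 5) / M * Real.log Real.pi ≤ 120 * (2 ^ 12 * 3 ^ 3 * 5 * D * l) := by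
    have h2a : 6 * l * ((l : ℝ) + 5) / M * Real.log Real.pi ≤ 6 * l * 3 :=
      mul_le_mul hq hlogpi hlogpi0 (by positivity)
    nlinarith
  linarith

/-! ## §2 The chain with the squeeze demanded only on the content locus -/

/-- **`Cor22.Thm110Legendre` from the Step (viii) squeeze with `B_III(P,l)` demanded ONLY where the display has content** (twin of
abc-iut-S-d2's `ThetaPartIIDisplay.thm110Legendre_of_squeezeIII`): pointwise (`thm110Legendre_of_pointwise`), on the content locus
`display_of_squeezeIII`, off it `display_of_not_content` (`η > 0` is part of `IsEtaPrm`). CONDITIONAL on `hsq`; nothing asserted.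
[claim: Mochizuki2012, status: disputed] [cite: Mochizuki2012, IUTchIV Thm. 1.10 Step (viii) p. 30; Cor. 2.2 (ii) proof p. 46] -/
theorem thm110Legendre_of_squeezeIII_content
    (hsq : ∀ P : NFPoint, P ∈ UP → ∀ l : ℕ, l.Prime → 5 ≤ l →
      Cor22.AdmitsCore P → Cor22.CondP2 P l → Cor22.CondP5 P l → Cor22.CondP6 P l →
      6 * ((1 + 20 * (Cor22.dmod P : ℝ) / l) * (P.logDiff + Cor22.logCondAvoid P {2, l}))
          + 120 * (2 ^ 12 * 3 ^ 3 * 5 * (Cor22.dmod P : ℝ) * l) < Cor22.logQAvoid P {2, l} →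
      (((l : ℝ) + 1) / 24 - 1 / (2 * l)) * Cor22.logQAvoid P {2, l} ≤
        ((l : ℝ) + 1) / 4 *
          ((1 + 12 * (Cor22.dmod P : ℝ) / l) * (P.logDiff + Cor22.logCondAvoid P {2, l})
            + 2 * Real.log l + 52
            + 20 / 3 * Real.log (((2 ^ 12 * 3 ^ 3 * 5 * Cor22.dmod P : ℕ) : ℝ) * (l : ℝ))
              * (Nat.primeCounting (2 ^ 12 * 3 ^ 3 * 5 * Cor22.dmod P * l) : ℝ))
        + ThetaVolumeInput.archLogTheta l) :
    Cor22.Thm110Legendre :=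
  ThetaPartIIDisplay.thm110Legendre_of_pointwise fun _ hη P hP l hl h5 hne hcore hP2 hP5 hP6 => by
    by_cases hct : 6 * ((1 + 20 * (Cor22.dmod P : ℝ) / l) * (P.logDiff + Cor22.logCondAvoid P {2, l}))
          + 120 * (2 ^ 12 * 3 ^ 3 * 5 * (Cor22.dmod P : ℝ) * l) < Cor22.logQAvoid P {2, l}
    · exact ThetaPartIIDisplay.display_of_squeezeIII hl h5 hne hη (hsq P hP l hl h5 hcore hP2 hP5 hP6 hct)
    · exact display_of_not_content hη.1 hct

/-- **`ABC` from the squeeze with `B_III(P,l)` demanded ONLY on the content locus** (`thm110Legendre_of_squeezeIII_content` +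
abc-iut-S6's `ABC_of_thm110Legendre`, i.e. the route's `closes` with `genEllTwo_holds` / `JInvWlog_proof`). CONDITIONAL on `hsq`.
[claim: Mochizuki2012, status: disputed] [cite: Mochizuki2012, IUTchIV Cor. 2.2–2.3 p. 41–55] -/
theorem ABC_of_squeezeIII_content
    (hsq : ∀ P : NFPoint, P ∈ UP → ∀ l : ℕ, l.Prime → 5 ≤ l →
      Cor22.AdmitsCore P → Cor22.CondP2 P l → Cor22.CondP5 P l → Cor22.CondP6 P l →
      6 * ((1 + 20 * (Cor22.dmod P : ℝ) / l) * (P.logDiff + Cor22.logCondAvoid P {2, l}))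
          + 120 * (2 ^ 12 * 3 ^ 3 * 5 * (Cor22.dmod P : ℝ) * l) < Cor22.logQAvoid P {2, l} →
      (((l : ℝ) + 1) / 24 - 1 / (2 * l)) * Cor22.logQAvoid P {2, l} ≤
        ((l : ℝ) + 1) / 4 *
          ((1 + 12 * (Cor22.dmod P : ℝ) / l) * (P.logDiff + Cor22.logCondAvoid P {2, l})
            + 2 * Real.log l + 52
            + 20 / 3 * Real.log (((2 ^ 12 * 3 ^ 3 * 5 * Cor22.dmod P : ℕ) : ℝ) * (l : ℝ))
              * (Nat.primeCounting (2 ^ 12 * 3 ^ 3 * 5 * Cor22.dmod P * l) : ℝ))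
        + ThetaVolumeInput.archLogTheta l) :
    _root_.ABC :=
  ABC_of_thm110Legendre (thm110Legendre_of_squeezeIII_content hsq)

/-! ## §3 The stable companion of record, θ-cut -/

/-- **`abc_of_SH_orNum_K_content`** — `ABC` from, per admissible `(P, l)` ON THE CONTENT LOCUS of [IUTchIV] Thm. 1.10's display
(`6·(1 + 20·d_mod/l)·(log-diff + log-cond) + 120·d*_mod·l < log q^{∤{2,l}}(λ)`) and genuine datum `T`: «if OUR typed (xi-f) licence FAILS
at the chosen realising ideles / pinned reading, then the number-level Corollary `T.Cor312Of`» (`hNumOffC`) and «if `T` is not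
slot-constant, the hull estimate `T.HullEstimateOf (B_III(P,l))`» (`hregC`) — abc-iut-C-cert-2's p452637 with the Szpiro-bad antecedent of
both binders replaced by the (stronger) content guard, everything else VERBATIM. Explicit 2 = NUM-OFF(content) 1 · CONE(content) 1; at every
admissible `(P, l)` off the content locus — in particular at every point with `log q^{∤{2,l}}(λ) ≤ 120·d*_mod·l`, hence at every known
point — NOTHING is assumed. «`ABC` follows from these hypotheses as typed» — no side taken on [IUTchIII] Cor. 3.12 or [IUTchIV] Thm. 1.10;
typed ≠ proved; instantiated ≠ endorsed. [claim: Mochizuki2012, status: disputed] [cite: Mochizuki2012, IUTchIV Thm. 1.10 Step (viii) p. 30] -/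
theorem abc_of_SH_orNum_K_content
    (M : ∀ (P : NFPoint) (l : ℕ) (T : Cor22.ThetaVolumeDatumAt P l), Type) [∀ P l T, Field (M P l T)] [∀ P l T, NumberField (M P l T)]
    (archPk : ∀ (P : NFPoint) (l : ℕ) (T : Cor22.ThetaVolumeDatumAt P l), letI := T.instFieldF; letI := T.instNumberFieldF; letI := T.instAlgebraF; letI := T.instFieldK;
        letI := T.instNumberFieldK; letI := T.instAlgebraK; letI := T.instFieldFbar; letI := T.instAlgebraFbar;
        letI := T.instAlgebraKFbar; letI := T.instIsElliptic;
      ∀ (j : (thetaIndex (pilotDataOfK T.D T.K)).Label) (vQ : (thetaIndex (pilotDataOfK T.D T.K)).VQ), Set ((logShellsDH (pilotDataOfK T.D T.K) (analyticLogv T.K)).Packet j vQ))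
    (archSub : ∀ (P : NFPoint) (l : ℕ) (T : Cor22.ThetaVolumeDatumAt P l), letI := T.instFieldF; letI := T.instNumberFieldF; letI := T.instAlgebraF; letI := T.instFieldK;
        letI := T.instNumberFieldK; letI := T.instAlgebraK; letI := T.instFieldFbar; letI := T.instAlgebraFbar;
        letI := T.instAlgebraKFbar; letI := T.instIsElliptic;
      ∀ (j : (thetaIndex (pilotDataOfK T.D T.K)).Label) (v : (thetaIndex (pilotDataOfK T.D T.K)).V), Set ((logShellsDH (pilotDataOfK T.D T.K) (analyticLogv T.K)).Packet j ((thetaIndex (pilotDataOfK T.D T.K)).over v)))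
    (Ψ : ∀ (P : NFPoint) (l : ℕ) (T : Cor22.ThetaVolumeDatumAt P l), letI := T.instFieldF; letI := T.instNumberFieldF; letI := T.instAlgebraF; letI := T.instFieldK;
        letI := T.instNumberFieldK; letI := T.instAlgebraK; letI := T.instFieldFbar; letI := T.instAlgebraFbar;
        letI := T.instAlgebraKFbar; letI := T.instIsElliptic;
      ℤ → ∀ v : (thetaIndex (pilotDataOfK T.D T.K)).V, v ∈ (thetaIndex (pilotDataOfK T.D T.K)).Vbad → Set ((logShellsDH (pilotDataOfK T.D T.K) (analyticLogv T.K)).StarPacket v))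
    (act : ∀ (P : NFPoint) (l : ℕ) (T : Cor22.ThetaVolumeDatumAt P l), letI := T.instFieldF; letI := T.instNumberFieldF; letI := T.instAlgebraF; letI := T.instFieldK;
        letI := T.instNumberFieldK; letI := T.instAlgebraK; letI := T.instFieldFbar; letI := T.instAlgebraFbar;
        letI := T.instAlgebraKFbar; letI := T.instIsElliptic;
      ℤ → ∀ v : (thetaIndex (pilotDataOfK T.D T.K)).V, v ∈ (thetaIndex (pilotDataOfK T.D T.K)).Vbad → (logShellsDH (pilotDataOfK T.D T.K) (analyticLogv T.K)).StarPacket v → Module.End ℚ ((logShellsDH (pilotDataOfK T.D T.K) (analyticLogv T.K)).StarPacket v))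
    (Mmod : ∀ (P : NFPoint) (l : ℕ) (T : Cor22.ThetaVolumeDatumAt P l), letI := T.instFieldF; letI := T.instNumberFieldF; letI := T.instAlgebraF; letI := T.instFieldK;
        letI := T.instNumberFieldK; letI := T.instAlgebraK; letI := T.instFieldFbar; letI := T.instAlgebraFbar;
        letI := T.instAlgebraKFbar; letI := T.instIsElliptic;
      ℤ → ∀ j : (thetaIndex (pilotDataOfK T.D T.K)).LabelStar, Set ((logShellsDH (pilotDataOfK T.D T.K) (analyticLogv T.K)).GlobalPacket j.1))
    (region : ∀ (P : NFPoint) (l : ℕ) (T : Cor22.ThetaVolumeDatumAt P l), letI := T.instFieldF; letI := T.instNumberFieldF; letI := T.instAlgebraF; letI := T.instFieldK;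
        letI := T.instNumberFieldK; letI := T.instAlgebraK; letI := T.instFieldFbar; letI := T.instAlgebraFbar;
        letI := T.instAlgebraKFbar; letI := T.instIsElliptic;
      ℤ → ∀ j : (thetaIndex (pilotDataOfK T.D T.K)).LabelStar, FinDivisor (M P l T) → ∀ vQ : (thetaIndex (pilotDataOfK T.D T.K)).VQ, Set ((logShellsDH (pilotDataOfK T.D T.K) (analyticLogv T.K)).Packet j.1 vQ))
    (frobAdm : ∀ (P : NFPoint) (l : ℕ) (T : Cor22.ThetaVolumeDatumAt P l), letI := T.instFieldF; letI := T.instNumberFieldF; letI := T.instAlgebraF; letI := T.instFieldK;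
        letI := T.instNumberFieldK; letI := T.instAlgebraK; letI := T.instFieldFbar; letI := T.instAlgebraFbar;
        letI := T.instAlgebraKFbar; letI := T.instIsElliptic;
      ℤ → ℤ → ∀ (j : (thetaIndex (pilotDataOfK T.D T.K)).Label) (vQ : (thetaIndex (pilotDataOfK T.D T.K)).VQ), Set ((logShellsDH (pilotDataOfK T.D T.K) (analyticLogv T.K)).Packet j vQ) → Prop)
    (frobLogvol : ∀ (P : NFPoint) (l : ℕ) (T : Cor22.ThetaVolumeDatumAt P l), letI := T.instFieldF; letI := T.instNumberFieldF; letI := T.instAlgebraF; letI := T.instFieldK;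
        letI := T.instNumberFieldK; letI := T.instAlgebraK; letI := T.instFieldFbar; letI := T.instAlgebraFbar;
        letI := T.instAlgebraKFbar; letI := T.instIsElliptic;
      ℤ → ℤ → ∀ (j : (thetaIndex (pilotDataOfK T.D T.K)).Label) (vQ : (thetaIndex (pilotDataOfK T.D T.K)).VQ), Set ((logShellsDH (pilotDataOfK T.D T.K) (analyticLogv T.K)).Packet j vQ) → ℝ)
    (frobΨ : ∀ (P : NFPoint) (l : ℕ) (T : Cor22.ThetaVolumeDatumAt P l), letI := T.instFieldF; letI := T.instNumberFieldF; letI := T.instAlgebraF; letI := T.instFieldK;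
        letI := T.instNumberFieldK; letI := T.instAlgebraK; letI := T.instFieldFbar; letI := T.instAlgebraFbar;
        letI := T.instAlgebraKFbar; letI := T.instIsElliptic;
      ℤ → ℤ → ∀ v : (thetaIndex (pilotDataOfK T.D T.K)).V, v ∈ (thetaIndex (pilotDataOfK T.D T.K)).Vbad → Set ((logShellsDH (pilotDataOfK T.D T.K) (analyticLogv T.K)).StarPacket v))
    (frobMmod : ∀ (P : NFPoint) (l : ℕ) (T : Cor22.ThetaVolumeDatumAt P l), letI := T.instFieldF; letI := T.instNumberFieldF; letI := T.instAlgebraF; letI := T.instFieldK;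
        letI := T.instNumberFieldK; letI := T.instAlgebraK; letI := T.instFieldFbar; letI := T.instAlgebraFbar;
        letI := T.instAlgebraKFbar; letI := T.instIsElliptic;
      ℤ → ℤ → ∀ j : (thetaIndex (pilotDataOfK T.D T.K)).LabelStar, Set ((logShellsDH (pilotDataOfK T.D T.K) (analyticLogv T.K)).GlobalPacket j.1))
    (unitImage : ∀ (P : NFPoint) (l : ℕ) (T : Cor22.ThetaVolumeDatumAt P l), letI := T.instFieldF; letI := T.instNumberFieldF; letI := T.instAlgebraF; letI := T.instFieldK;
        letI := T.instNumberFieldK; letI := T.instAlgebraK; letI := T.instFieldFbar; letI := T.instAlgebraFbar;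
        letI := T.instAlgebraKFbar; letI := T.instIsElliptic;
      ℤ → ℤ → ℕ → ∀ (j : (thetaIndex (pilotDataOfK T.D T.K)).Label) (vQ : (thetaIndex (pilotDataOfK T.D T.K)).VQ), Set ((logShellsDH (pilotDataOfK T.D T.K) (analyticLogv T.K)).Packet j vQ))
    (ballImage : ∀ (P : NFPoint) (l : ℕ) (T : Cor22.ThetaVolumeDatumAt P l), letI := T.instFieldF; letI := T.instNumberFieldF; letI := T.instAlgebraF; letI := T.instFieldK;
        letI := T.instNumberFieldK; letI := T.instAlgebraK; letI := T.instFieldFbar; letI := T.instAlgebraFbar;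
        letI := T.instAlgebraKFbar; letI := T.instIsElliptic;
      ℤ → ℤ → ∀ (j : (thetaIndex (pilotDataOfK T.D T.K)).Label) (vQ : (thetaIndex (pilotDataOfK T.D T.K)).VQ), Set ((logShellsDH (pilotDataOfK T.D T.K) (analyticLogv T.K)).Packet j vQ))
    (thetaDiv : ∀ (P : NFPoint) (l : ℕ) (T : Cor22.ThetaVolumeDatumAt P l), letI := T.instFieldF; letI := T.instNumberFieldF; letI := T.instAlgebraF; letI := T.instFieldK;
        letI := T.instNumberFieldK; letI := T.instAlgebraK; letI := T.instFieldFbar; letI := T.instAlgebraFbar;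
        letI := T.instAlgebraKFbar; letI := T.instIsElliptic;
      ℤ → ℤ → LgpDivisor (M P l T) (thetaIndex (pilotDataOfK T.D T.K)).lstar)
    (n : ∀ (P : NFPoint) (l : ℕ) (T : Cor22.ThetaVolumeDatumAt P l), ℤ)
    {HT : ∀ (P : NFPoint) (l : ℕ) (T : Cor22.ThetaVolumeDatumAt P l), Type} {LogLink : ∀ (P : NFPoint) (l : ℕ) (T : Cor22.ThetaVolumeDatumAt P l), HT P l T → HT P l T → Type}
    {IsFull : ∀ (P : NFPoint) (l : ℕ) (T : Cor22.ThetaVolumeDatumAt P l), ∀ {s t : HT P l T}, LogLink P l T s t → Prop}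
    (lat : ∀ (P : NFPoint) (l : ℕ) (T : Cor22.ThetaVolumeDatumAt P l), LGPGaussianLogThetaLattice (LogLink P l T) (IsFull P l T))
    {Frd : ∀ (P : NFPoint) (l : ℕ) (T : Cor22.ThetaVolumeDatumAt P l), Type} {IsoF : ∀ (P : NFPoint) (l : ℕ) (T : Cor22.ThetaVolumeDatumAt P l), Frd P l T → Frd P l T → Type} {Ob : ∀ (P : NFPoint) (l : ℕ) (T : Cor22.ThetaVolumeDatumAt P l), Frd P l T → Type}
    {realify : ∀ (P : NFPoint) (l : ℕ) (T : Cor22.ThetaVolumeDatumAt P l), Frd P l T → Frd P l T} {Strip : ∀ (P : NFPoint) (l : ℕ) (T : Cor22.ThetaVolumeDatumAt P l), Type} {IsoS : ∀ (P : NFPoint) (l : ℕ) (T : Cor22.ThetaVolumeDatumAt P l), Strip P l T → Strip P l T → Type}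
    {Mv : ∀ (P : NFPoint) (l : ℕ) (T : Cor22.ThetaVolumeDatumAt P l), letI := T.instFieldF; letI := T.instNumberFieldF; letI := T.instAlgebraF; letI := T.instFieldK;
        letI := T.instNumberFieldK; letI := T.instAlgebraK; letI := T.instFieldFbar; letI := T.instAlgebraFbar;
        letI := T.instAlgebraKFbar; letI := T.instIsElliptic;
      ∀ v : (thetaIndex (pilotDataOfK T.D T.K)).V, v ∈ (thetaIndex (pilotDataOfK T.D T.K)).Vbad → Type}
    [∀ P l T v h, Monoid (Mv P l T v h)]
    (sig : ∀ (P : NFPoint) (l : ℕ) (T : Cor22.ThetaVolumeDatumAt P l), letI := T.instFieldF; letI := T.instNumberFieldF; letI := T.instAlgebraF; letI := T.instFieldK;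
        letI := T.instNumberFieldK; letI := T.instAlgebraK; letI := T.instFieldFbar; letI := T.instAlgebraFbar;
        letI := T.instAlgebraKFbar; letI := T.instIsElliptic;
      GlobalLGPFrobenioidSignature (thetaIndex (pilotDataOfK T.D T.K)).lstar (thetaIndex (pilotDataOfK T.D T.K)).V (· ∈ (thetaIndex (pilotDataOfK T.D T.K)).Vbad) (Frd P l T) (IsoF P l T) (Ob P l T) (realify P l T)
        (Strip P l T) (IsoS P l T) (Mv P l T))
    (split : ∀ (P : NFPoint) (l : ℕ) (T : Cor22.ThetaVolumeDatumAt P l), SplittingMonoids (Mv P l T))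
    {ObΔ : ∀ (P : NFPoint) (l : ℕ) (T : Cor22.ThetaVolumeDatumAt P l), Type} {N : ∀ (P : NFPoint) (l : ℕ) (T : Cor22.ThetaVolumeDatumAt P l), letI := T.instFieldF; letI := T.instNumberFieldF; letI := T.instAlgebraF; letI := T.instFieldK;
        letI := T.instNumberFieldK; letI := T.instAlgebraK; letI := T.instFieldFbar; letI := T.instAlgebraFbar;
        letI := T.instAlgebraKFbar; letI := T.instIsElliptic;
      ∀ v : (thetaIndex (pilotDataOfK T.D T.K)).V, v ∈ (thetaIndex (pilotDataOfK T.D T.K)).Vbad → Type}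
    [∀ P l T v h, Monoid (N P l T v h)] (qData : ∀ (P : NFPoint) (l : ℕ) (T : Cor22.ThetaVolumeDatumAt P l), QPilotData (ObΔ P l T) (N P l T))
    (qK : ∀ (P : NFPoint) (l : ℕ) (T : Cor22.ThetaVolumeDatumAt P l), letI := T.instFieldF; letI := T.instNumberFieldF; letI := T.instAlgebraF; letI := T.instFieldK;
        letI := T.instNumberFieldK; letI := T.instAlgebraK; letI := T.instFieldFbar; letI := T.instAlgebraFbar;
        letI := T.instAlgebraKFbar; letI := T.instIsElliptic;
      ∀ v : (thetaIndex (pilotDataOfK T.D T.K)).V, v ∈ (thetaIndex (pilotDataOfK T.D T.K)).Vbad → Set ((logShellsDH (pilotDataOfK T.D T.K) (analyticLogv T.K)).StarPacket v))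
    (hNumOffC : ∀ (P : NFPoint), P ∈ UP → ∀ (l : ℕ), l.Prime → 5 ≤ l →
      Cor22.AdmitsCore P → Cor22.CondP2 P l → Cor22.CondP5 P l → Cor22.CondP6 P l →
      -- ONLY where [IUTchIV] Thm. 1.10's DISPLAY HAS CONTENT at `(P, l)`: off this locus `Cor22.Display P l η` holds for every `η > 0` by print's own
      -- additive constant `20·(d*_mod·l + η)` (`display_of_not_content`); the guard implies the Szpiro-bad guard of p452637 (`szpiroBad_of_content`)
      6 * ((1 + 20 * (Cor22.dmod P : ℝ) / l) * (P.logDiff + Cor22.logCondAvoid P {2, l}))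
          + 120 * (2 ^ 12 * 3 ^ 3 * 5 * (Cor22.dmod P : ℝ) * l) < Cor22.logQAvoid P {2, l} →
      ∀ (T : Cor22.ThetaVolumeDatumAt P l), letI := T.instFieldF; letI := T.instNumberFieldF; letI := T.instAlgebraF; letI := T.instFieldK;
        letI := T.instNumberFieldK; letI := T.instAlgebraK; letI := T.instFieldFbar; letI := T.instAlgebraFbar;
        letI := T.instAlgebraKFbar; letI := T.instIsElliptic;
      -- … and ONLY where OUR typed licence FAILS at the chosen ideles / pinned reading:
      ¬ (Cor312Vol.PilotKummerCompatHull
        (LatticeSituation.ofShells (logShellsDH (pilotDataOfK T.D T.K) (analyticLogv T.K)) (M P l T) (archPk P l T)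
          (archSub P l T) (summandPiecesPr (pilotDataOfK T.D T.K) (logvAnalytic_analyticLogv (F := T.K))).Adm
          (summandPiecesPr (pilotDataOfK T.D T.K) (logvAnalytic_analyticLogv (F := T.K))).logvol (Ψ P l T) (act P l T) (Mmod P l T)
          (region P l T) (frobAdm P l T) (frobLogvol P l T) (frobΨ P l T) (frobMmod P l T) (unitImage P l T)
          (ballImage P l T) (thetaDiv P l T))
        (settingPrVolSharp (pilotDataOfK T.D T.K) (logvAnalytic_analyticLogv (F := T.K)) (M P l T) (archPk P l T) (archSub P l T) (Ψ P l T)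
          (act P l T) (Mmod P l T) (region P l T) (n P l T) (lat P l T) (sig P l T) (split P l T) (qData P l T)
          (exists_realising_qIdeles_pilotDataOfK T.D).choose
          (exists_realising_thetaIdeles_pilotDataOfK T.D).choose
          (exists_realising_qIdeles_pilotDataOfK T.D).choose_spec.1
          (exists_realising_qIdeles_pilotDataOfK T.D).choose_spec.2.1)
        (fun _ => Cor312.Setting.qRegion
        (settingPrVolSharp (pilotDataOfK T.D T.K) (logvAnalytic_analyticLogv (F := T.K)) (M P l T) (archPk P l T) (archSub P l T) (Ψ P l T)
          (act P l T) (Mmod P l T) (region P l T) (n P l T) (lat P l T) (sig P l T) (split P l T) (qData P l T)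
          (exists_realising_qIdeles_pilotDataOfK T.D).choose
          (exists_realising_thetaIdeles_pilotDataOfK T.D).choose
          (exists_realising_qIdeles_pilotDataOfK T.D).choose_spec.1
          (exists_realising_qIdeles_pilotDataOfK T.D).choose_spec.2.1)) (qK P l T)) → T.Cor312Of)
    -- [CONE, content locus] the off-regime hull estimate with print's constant `B_III(P,l)`, demanded ONLY where the display has content at `(P, l)`
    (hregC : ∀ P : NFPoint, P ∈ UP → ∀ l : ℕ, l.Prime → 5 ≤ l →
      Cor22.AdmitsCore P → Cor22.CondP2 P l → Cor22.CondP5 P l → Cor22.CondP6 P l →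
      6 * ((1 + 20 * (Cor22.dmod P : ℝ) / l) * (P.logDiff + Cor22.logCondAvoid P {2, l}))
          + 120 * (2 ^ 12 * 3 ^ 3 * 5 * (Cor22.dmod P : ℝ) * l) < Cor22.logQAvoid P {2, l} →
      ∀ T : Cor22.ThetaVolumeDatumAt P l,
        (letI := T.instFieldF; letI := T.instNumberFieldF; letI := T.instAlgebraF; letI := T.instFieldK
         letI := T.instNumberFieldK; letI := T.instAlgebraK; letI := T.instFieldFbar; letI := T.instAlgebraFbar
         letI := T.instAlgebraKFbar; letI := T.instIsElliptic
         ¬ (∀ p ∈ T.I.supportPrimes, ∀ v w : placesOver (fieldOfModuli T.E) p,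
            (Summit.ABC.IUTFork.DHData.ofInput T.I).logQloc p v = (Summit.ABC.IUTFork.DHData.ofInput T.I).logQloc p w)) →
        T.HullEstimateOf
          (((l : ℝ) + 1) / 4 *
            ((1 + 12 * (Cor22.dmod P : ℝ) / l) * (P.logDiff + Cor22.logCondAvoid P {2, l})
              + 2 * Real.log l + 52
              + 20 / 3 * Real.log (((2 ^ 12 * 3 ^ 3 * 5 * Cor22.dmod P : ℕ) : ℝ) * (l : ℝ))
                * (Nat.primeCounting (2 ^ 12 * 3 ^ 3 * 5 * Cor22.dmod P * l) : ℝ))))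
    : _root_.ABC := by
  refine ABC_of_squeezeIII_content fun P hP l hl h5 hc h2 h5' h6 hct => ?_
  -- a genuine Θ-volume datum exists at the admissible `(P, l)` (abc-iut-L5-t7), and `l ≥ 7` by (P6)
  obtain ⟨T⟩ := ThetaPartII.stub_thetaData P hP l hl h5 hc h2 h5' h6
  have h7 : 7 ≤ l := ThetaPartII.seven_le_of_condP6 hP hl h5 h6
  -- ON THE CONTENT LOCUS (p452637's Szpiro-bad branch VERBATIM with `hbad ↦ hct`): `Cor22.Cor312AtDatum P l` per datum from the licence
  -- (`GenuineK.cor312Of_of_SH`, Θ-READ by abc-iut-s2-p6) or `hNumOffC`; `Cor22.HullVolumeAtDatum P l (B_III)` per datum from the pinned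
  -- junction (slot-constant, abc-iut-S3, (R4) abc-iut-S1) or `hregC`; then abc-iut-S2's squeeze `PointDict.logQAvoid_le_of_cor312AtDatum`.
  have h312 : Cor22.Cor312AtDatum P l := by
    intro T'
    letI := T'.instFieldF; letI := T'.instNumberFieldF; letI := T'.instAlgebraF; letI := T'.instFieldK
    letI := T'.instNumberFieldK; letI := T'.instAlgebraK; letI := T'.instFieldFbar; letI := T'.instAlgebraFbar
    letI := T'.instAlgebraKFbar; letI := T'.instIsElliptic
    by_cases hS : (Cor312Vol.PilotKummerCompatHull
          (LatticeSituation.ofShells (logShellsDH (pilotDataOfK T'.D T'.K) (analyticLogv T'.K)) (M P l T') (archPk P l T')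
            (archSub P l T') (summandPiecesPr (pilotDataOfK T'.D T'.K) (logvAnalytic_analyticLogv (F := T'.K))).Adm
            (summandPiecesPr (pilotDataOfK T'.D T'.K) (logvAnalytic_analyticLogv (F := T'.K))).logvol (Ψ P l T') (act P l T') (Mmod P l T')
            (region P l T') (frobAdm P l T') (frobLogvol P l T') (frobΨ P l T') (frobMmod P l T') (unitImage P l T')
            (ballImage P l T') (thetaDiv P l T'))
          (settingPrVolSharp (pilotDataOfK T'.D T'.K) (logvAnalytic_analyticLogv (F := T'.K)) (M P l T') (archPk P l T') (archSub P l T') (Ψ P l T')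
            (act P l T') (Mmod P l T') (region P l T') (n P l T') (lat P l T') (sig P l T') (split P l T') (qData P l T')
            (exists_realising_qIdeles_pilotDataOfK T'.D).choose
            (exists_realising_thetaIdeles_pilotDataOfK T'.D).choose
            (exists_realising_qIdeles_pilotDataOfK T'.D).choose_spec.1
            (exists_realising_qIdeles_pilotDataOfK T'.D).choose_spec.2.1)
          (fun _ => Cor312.Setting.qRegion
          (settingPrVolSharp (pilotDataOfK T'.D T'.K) (logvAnalytic_analyticLogv (F := T'.K)) (M P l T') (archPk P l T') (archSub P l T') (Ψ P l T')
            (act P l T') (Mmod P l T') (region P l T') (n P l T') (lat P l T') (sig P l T') (split P l T') (qData P l T')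
            (exists_realising_qIdeles_pilotDataOfK T'.D).choose
            (exists_realising_thetaIdeles_pilotDataOfK T'.D).choose
            (exists_realising_qIdeles_pilotDataOfK T'.D).choose_spec.1
            (exists_realising_qIdeles_pilotDataOfK T'.D).choose_spec.2.1)) (qK P l T'))
    · exact GenuineK.cor312Of_of_SH T'.D T'.K (M P l T') (archPk P l T') (archSub P l T') (Ψ P l T') (act P l T') (Mmod P l T')
        (region P l T') (frobAdm P l T') (frobLogvol P l T') (frobΨ P l T') (frobMmod P l T') (unitImage P l T') (ballImage P l T')
        (thetaDiv P l T') (n P l T') (lat P l T') (sig P l T') (split P l T') (qData P l T')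
        (exists_realising_thetaIdeles_pilotDataOfK T'.D).choose (exists_realising_qIdeles_pilotDataOfK T'.D).choose
        (fun _ => Cor312.Setting.qRegion
            (settingPrVolSharp (pilotDataOfK T'.D T'.K) (logvAnalytic_analyticLogv (F := T'.K)) (M P l T') (archPk P l T') (archSub P l T') (Ψ P l T')
            (act P l T') (Mmod P l T') (region P l T') (n P l T') (lat P l T') (sig P l T') (split P l T') (qData P l T')
            (exists_realising_qIdeles_pilotDataOfK T'.D).choose
            (exists_realising_thetaIdeles_pilotDataOfK T'.D).choose
            (exists_realising_qIdeles_pilotDataOfK T'.D).choose_spec.1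
            (exists_realising_qIdeles_pilotDataOfK T'.D).choose_spec.2.1)) (qK P l T')
        T'.isVolumeInputOf (exists_realising_qIdeles_pilotDataOfK T'.D).choose_spec.1
        (exists_realising_qIdeles_pilotDataOfK T'.D).choose_spec.2.1 (exists_realising_thetaIdeles_pilotDataOfK T'.D).choose_spec.1
        (exists_realising_thetaIdeles_pilotDataOfK T'.D).choose_spec.2.1 (exists_realising_qIdeles_pilotDataOfK T'.D).choose_spec.2.2
        hS (fun _ _ => rfl)
        (negLogTheta_settingPrVolSharp_pilotDataOfK_le_datum T' (M P l T') (archPk P l T') (archSub P l T') (Ψ P l T') (act P l T')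
          (Mmod P l T') (region P l T') (n P l T') (lat P l T') (sig P l T') (split P l T') (qData P l T')
          (exists_realising_qIdeles_pilotDataOfK T'.D).choose (exists_realising_thetaIdeles_pilotDataOfK T'.D).choose
          (exists_realising_qIdeles_pilotDataOfK T'.D).choose_spec.1 (exists_realising_qIdeles_pilotDataOfK T'.D).choose_spec.2.1
          (exists_realising_thetaIdeles_pilotDataOfK T'.D).choose_spec.1 (exists_realising_thetaIdeles_pilotDataOfK T'.D).choose_spec.2.2)
    · exact hNumOffC P hP l hl h5 hc h2 h5' h6 hct T' hS
  have hvol : Cor22.HullVolumeAtDatum P l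
      (((l : ℝ) + 1) / 4 *
        ((1 + 12 * (Cor22.dmod P : ℝ) / l) * (P.logDiff + Cor22.logCondAvoid P {2, l})
          + 2 * Real.log l + 52
          + 20 / 3 * Real.log (((2 ^ 12 * 3 ^ 3 * 5 * Cor22.dmod P : ℕ) : ℝ) * (l : ℝ))
            * (Nat.primeCounting (2 ^ 12 * 3 ^ 3 * 5 * Cor22.dmod P * l) : ℝ))) := by
    intro T'
    letI := T'.instFieldF; letI := T'.instNumberFieldF; letI := T'.instAlgebraF; letI := T'.instFieldK
    letI := T'.instNumberFieldK; letI := T'.instAlgebraK; letI := T'.instFieldFbar; letI := T'.instAlgebraFbar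
    letI := T'.instAlgebraKFbar; letI := T'.instIsElliptic
    by_cases hcst : ∀ p ∈ T'.I.supportPrimes, ∀ v w : placesOver (fieldOfModuli T'.E) p,
        (Summit.ABC.IUTFork.DHData.ofInput T'.I).logQloc p v = (Summit.ABC.IUTFork.DHData.ofInput T'.I).logQloc p w
    · -- slot-constant: abc-iut-S3's pinned junction, (R4) by abc-iut-S1 — NOTHING assumed
      exact PointDict.hullEstimateOf_BIII_pinned T' hP h7 (ThetaPartII.stub_R4 P hP l hl h5 hc h2 h5' h6 T') hcst
    · exact hregC P hP l hl h5 hc h2 h5' h6 hct T' hcst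
  exact PointDict.logQAvoid_le_of_cor312AtDatum h312 hvol T hP.1

end Summit.ABC.IUTFork.Conditional
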